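import Summits.KontsevichZagierPeriods.KontsevichZagierPeriods.Theorems.RootDecompQuadraticDescentPair18ReductionP2

/-! # `RootDecompQuadraticDescentPair18ReductionP3` — part 3/7 of the mechanical ≤400-line split of `Pair18Reduction_v5_landing.lean` (sha256 0a10c70876ba8bf2…)
Source: decomp-kz lens-6 g8 `Pair18Reduction.lean` v5 (HOME/decomp-kz-lens-6/g8/, sha256 9036e907…; critic g3 CLEARED 12:08:58Z/13:14:52Z): census pair #18 reduced to strips — `pair18_iff_strips : KZ.of A18.rep − 2 • KZ.of B18.rep ∈ KZ.relations ↔ [U1] − [U2r] + [SL] − 2•[K12c] + 2•[Kh] ∈ KZ.relations` (namespace …RootDecompQuadraticDescent.Pair18); `#print axioms` pins removed for landing.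
Split by census-1 g9 `gen/splitlean.py`: scopes re-opened with their `open`/`variable`/`set_option` context; mathematics and declaration order unchanged. -/

noncomputable section
open MeasureTheory Set MvPolynomial
namespace Summit.KontsevichZagierPeriods.RootDecompQuadraticDescent.Pair18
open Literature.NumberTheory.Transcendental
open Literature.NumberTheory.Transcendental.KZ
open Literature.ModelTheory.ExponentialFields (IsSemialgebraic continuous_aeval_real)
open Summit.KontsevichZagierPeriods.RootDecompQuadraticDescent.DarkPairs (rel_reflect_rep rel_double
  update_one_apply_zero one_div_eq_mul_one_div)
/-- Auxiliary step `snoc2_zero` (§1): snoc2 zero. [bookkeeping] -/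
@[simp] private theorem snoc2_zero (x : Fin 1 → ℝ) (t : ℝ) : (Fin.snoc x t : Fin 2 → ℝ) 0 = x 0 := rfl

/-- Auxiliary step `snoc2_one` (§1): snoc2 one. [bookkeeping] -/
@[simp] private theorem snoc2_one (x : Fin 1 → ℝ) (t : ℝ) : (Fin.snoc x t : Fin 2 → ℝ) 1 = t := rfl

/-- Auxiliary step `rel_trans` (§2): rel trans. [bookkeeping] -/
private theorem rel_trans {a b c : KZ.FormalRep} (h₁ : a - b ∈ KZ.relations) (h₂ : b - c ∈ KZ.relations) :
    a - c ∈ KZ.relations := by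
  have h := add_mem h₁ h₂
  rwa [sub_add_sub_cancel] at h

/-- Auxiliary step `rel_symm` (§2): rel symm. [bookkeeping] -/
private theorem rel_symm {a b : KZ.FormalRep} (h : a - b ∈ KZ.relations) : b - a ∈ KZ.relations := by
  have h' := neg_mem h
  rwa [neg_sub] at h'

/-- Auxiliary step `last_one_eq` (§1): last one eq. [bookkeeping] -/
private theorem last_one_eq : (Fin.last 1 : Fin 2) = 1 := rfl

/-- Injectivity and image of an interval under a map with positive derivative in the interior. -/
private theorem injOn_image_of_deriv_pos' {κ κd : ℝ → ℝ} {a b : ℝ} (hab : a ≤ b)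
    (hκd : ∀ t ∈ Icc a b, HasDerivAt κ (κd t) t) (hpos : ∀ t ∈ Ioo a b, 0 < κd t) :
    InjOn κ (Icc a b) ∧ κ '' Icc a b = Icc (κ a) (κ b) := by
  have hc : ContinuousOn κ (Icc a b) := fun t ht => (hκd t ht).continuousAt.continuousWithinAt
  have hm : StrictMonoOn κ (Icc a b) := strictMonoOn_of_deriv_pos (convex_Icc a b) hc fun t ht => by
    rw [interior_Icc] at ht
    rw [(hκd t (Ioo_subset_Icc_self ht)).deriv]
    exact hpos t ht
  refine ⟨hm.injOn, Subset.antisymm ?_ (intermediate_value_Icc hab hc)⟩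
  rintro _ ⟨t, ht, rfl⟩
  exact ⟨hm.monotoneOn (left_mem_Icc.2 hab) ht ht.1, hm.monotoneOn ht (right_mem_Icc.2 hab) ht.2⟩

/-- Auxiliary step `init2_zero` (§1): init2 zero. [bookkeeping] -/
@[simp] private theorem init2_zero (z : Fin 2 → ℝ) : Fin.init z 0 = z 0 := rfl

/-- **(box → band)** the affine fibre substitution `s = 1 + E(t)·σ` from the square onto the shifted
band `{1 ≤ s ≤ 1 + E(t)}`, for an edge `E` positive and differentiable on the OPEN base (it may vanish
at `t = 0, 1`): rule 2 over the open base (`KZ.of_sub_of_mem_relations_of_affine`) between two null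
moves. -/
private theorem box_to_band (E : Edge) (hEpos : ∀ t ∈ Ioo (0 : ℝ) 1, 0 < E.f t)
    (hEd : DifferentiableOn ℝ E.f (Ioo 0 1)) (P : RFun 2) (R : KZ.IntegralRep 2)
    (hR : R.domain = sbDom oneE E.onePlus)
    (hint : ∀ z ∈ cube 2, 0 < z 0 → z 0 < 1 →
      P.fn z = R.integrand (Fin.snoc (Fin.init z) (1 + E.f (z 0) * z 1)) * E.f (z 0)) :
    KZ.of P.rep - KZ.of R ∈ KZ.relations := by
  have hP : P.rep.domain = sbDom zeroE oneE := by rw [RFun.rep_domain, cube_eq_sbDom]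
  have h1 := rel_open P.rep zeroE oneE hP
  have h3 := rel_open R oneE E.onePlus hR
  have h2 : KZ.of (OB P.rep zeroE oneE hP) - KZ.of (OB R oneE E.onePlus hR) ∈ KZ.relations := by
    refine of_sub_of_mem_relations_of_affine isOpen_Gopen (α := fun _ => (1 : ℝ))
      (β := fun y => E.f (y 0)) (a := fun y => zeroE.f (y 0)) (b := fun y => oneE.f (y 0))
      (a' := fun y => oneE.f (y 0)) (b' := fun y => E.onePlus.f (y 0)) ?_
      (E.sa.mono Gopen_subset isSemialgebraic_Gopen) (differentiableOn_const _) ?_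
      (fun y hy => hEpos _ ⟨hy.1, hy.2⟩) _ _ rfl rfl (fun y _ => by simp) (fun y _ => by simp)
      fun z hz => ?_
    · simpa using isSemialgebraicFunOn_ratCast isSemialgebraic_Gopen 1
    · exact hEd.comp (fun y _ => (differentiableAt_apply (𝕜 := ℝ) 0 y).differentiableWithinAt)
        fun y hy => ⟨hy.1, hy.2⟩
    · have hz' : z ∈ obDom zeroE oneE := hz
      rw [mem_obDom] at hz'
      have hzc : z ∈ cube 2 := by
        rw [cube_eq_sbDom]; exact obDom_subset zeroE oneE hz
      rw [OB_integrand, OB_integrand, RFun.rep_integrand, last_one_eq]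
      simpa only [init2_zero] using hint z hzc hz'.1.1 hz'.1.2
  exact rel_trans (rel_trans h1 h2) (rel_symm h3)

/-- Linearity in the integrand (rule 1b). -/
private theorem rel_lin (T S U : RFun 2) (h : ∀ x ∈ cube 2, T.fn x = S.fn x + U.fn x) :
    KZ.of T.rep - KZ.of S.rep - KZ.of U.rep ∈ KZ.relations :=
  KZ.cubicalLinGens_subset_relations (KZ.mem_cubicalLinGens T.isTameCube_rep S.isTameCube_rep
    U.isTameCube_rep fun x hx => by simpa using h x hx)

/-! ### The edges `1 − t`, `t/(1+t)`, `1/(1+t)` -/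

/-- Auxiliary definition `omE`: om E. [bookkeeping] -/
def omE : Edge := mkEdge (fun t => 1 - t) (1 - X 0) 1 (fun y _ => by simp) (fun y _ => by simp)
  (fun t ht => by linarith [ht.2]) (by fun_prop)
/-- Auxiliary definition `tqE`: tq E. [bookkeeping] -/
def tqE : Edge := mkEdge (fun t => t / (1 + t)) (X 0) (1 + X 0)
  (fun y hy => by have := (I01 hy).1; simp only [map_add, map_one, aeval_X]; positivity)
  (fun y _ => by simp) (fun t ht => by have := ht.1; positivity)
  (ContinuousOn.div (by fun_prop) (by fun_prop) fun t ht => by have := ht.1; positivity)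
/-- Auxiliary definition `rE`: r E. [bookkeeping] -/
def rE : Edge := mkEdge (fun t => 1 / (1 + t)) 1 (1 + X 0)
  (fun y hy => by have := (I01 hy).1; simp only [map_add, map_one, aeval_X]; positivity)
  (fun y _ => by simp) (fun t ht => by have := ht.1; positivity)
  (ContinuousOn.div (by fun_prop) (by fun_prop) fun t ht => by have := ht.1; positivity)

/-- Auxiliary step `omE_f`: om E f. [bookkeeping] -/
@[simp] theorem omE_f (t : ℝ) : omE.f t = 1 - t := rfl
/-- Auxiliary step `tqE_f`: tq E f. [bookkeeping] -/
@[simp] theorem tqE_f (t : ℝ) : tqE.f t = t / (1 + t) := rfl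
/-- Auxiliary step `rE_f`: r E f. [bookkeeping] -/
@[simp] theorem rE_f (t : ℝ) : rE.f t = 1 / (1 + t) := rfl

/-! ## §5 The c-trick: `TΔ(c) = [Δ, dw dv/(1 + c·w·v)] ≡ G(c) = [□², du dσ/((1+u)² + c·u·σ)]` (`|c| ≤ 1`)

`Δ = {0 ≤ w ≤ 1, 0 ≤ v ≤ 1 − w}`.  Fibrewise `∫₀^{1−w} dv/(1 + c w v) = log(1 + c·w(1−w))/(c w)`, and
`q(w) = 1 + c·w(1−w)` is symmetric under `w ↦ 1 − w`; cutting at `w = ½`, folding the right half onto the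
left by `w ↦ 1 − w` and substituting `w = u/(1+u)` (so that `w(1−w) = u/(1+u)²`) turns `TΔ(c)` into the
LINEAR-FIBRE box form `G(c)`, whose fibre integral is `log(((1+u)² + c u)/(1+u)²)/u`.  Every step is a
move of rule 1 or rule 2 (cuts, shifts, base charts `u ↦ 1/(1+u)`, `u ↦ u/(1+u)`, affine fibre maps). -/

/-- Auxiliary step `cmul_ge_neg` (§5): cmul ge neg. [bookkeeping] -/
theorem cmul_ge_neg {c : ℚ} (hc : -1 ≤ c ∧ c ≤ 1) {p : ℝ} (hp : 0 ≤ p) : -p ≤ (c : ℝ) * p := by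
  have h1 : (-1 : ℝ) ≤ c := by exact_mod_cast hc.1
  nlinarith

/-- The polynomial data. -/
def PΔ (c : ℚ) : MvPolynomial (Fin 2) ℚ := 1 + C c * X 0 * X 1
/-- Auxiliary definition `PΔs` (§5): PΔs. [bookkeeping] -/
def PΔs (c : ℚ) : MvPolynomial (Fin 2) ℚ := 1 + C c * X 0 * (X 1 - 1)
/-- Auxiliary definition `Q1` (§5): Q1. [bookkeeping] -/
def Q1 (c : ℚ) : MvPolynomial (Fin 2) ℚ := (1 + X 0) * (1 + X 0 + C c * (X 1 - 1))
/-- Auxiliary definition `Q2` (§5): Q2. [bookkeeping] -/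
def Q2 (c : ℚ) : MvPolynomial (Fin 2) ℚ := (1 + X 0) * (1 + X 0 + C c * X 0 * (X 1 - 1))
/-- Auxiliary definition `QG` (§5): QG. [bookkeeping] -/
def QG (c : ℚ) : MvPolynomial (Fin 2) ℚ := (1 + X 0) ^ 2 + C c * X 0 * X 1
/-- Auxiliary definition `QP` (§5): QP. [bookkeeping] -/
def QP (c : ℚ) : MvPolynomial (Fin 2) ℚ := (1 + X 0) * ((1 + X 0) ^ 2 + C c * X 0 * X 1)

/-- Auxiliary step `PΔ_ge` (§5): PΔ ge. [bookkeeping] -/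
theorem PΔ_ge {c : ℚ} (hc : -1 ≤ c ∧ c ≤ 1) {z : Fin 2 → ℝ} (hz : z ∈ sbDom zeroE omE) :
    (3 / 4 : ℝ) ≤ aeval z (PΔ c) := by
  obtain ⟨⟨h0, h0'⟩, h1, h2⟩ := mem_sbDom.1 hz
  simp only [zeroE_f, omE_f] at h1 h2
  simp only [PΔ, map_add, map_mul, map_one, aeval_C, aeval_X, eq_ratCast]
  have hp : 0 ≤ z 0 * z 1 := mul_nonneg h0 h1
  have hq1 : z 0 * z 1 ≤ z 0 * (1 - z 0) := mul_le_mul_of_nonneg_left h2 h0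
  have hq : z 0 * z 1 ≤ 1 / 4 := by nlinarith [sq_nonneg (z 0 - 1 / 2)]
  have := cmul_ge_neg hc hp
  nlinarith

/-- Auxiliary step `PΔs_ge` (§5): PΔs ge. [bookkeeping] -/
theorem PΔs_ge {c : ℚ} (hc : -1 ≤ c ∧ c ≤ 1) {z : Fin 2 → ℝ} (hz : z ∈ sbDom oneE omE.onePlus) :
    (3 / 4 : ℝ) ≤ aeval z (PΔs c) := by
  obtain ⟨⟨h0, h0'⟩, h1, h2⟩ := mem_sbDom.1 hz
  simp only [oneE_f, Edge.onePlus_f, omE_f] at h1 h2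
  simp only [PΔs, map_add, map_mul, map_sub, map_one, aeval_C, aeval_X, eq_ratCast]
  have hp : 0 ≤ z 0 * (z 1 - 1) := mul_nonneg h0 (by linarith)
  have hq1 : z 0 * (z 1 - 1) ≤ z 0 * (1 - z 0) := mul_le_mul_of_nonneg_left (by linarith) h0
  have hq : z 0 * (z 1 - 1) ≤ 1 / 4 := by nlinarith [sq_nonneg (z 0 - 1 / 2)]
  have := cmul_ge_neg hc hp
  nlinarith

/-- Auxiliary step `Q1_ge` (§5): Q1 ge. [bookkeeping] -/
theorem Q1_ge {c : ℚ} (hc : -1 ≤ c ∧ c ≤ 1) {z : Fin 2 → ℝ} (hz : z ∈ sbDom oneE tqE.onePlus) :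
    (1 : ℝ) ≤ aeval z (Q1 c) := by
  obtain ⟨⟨h0, h0'⟩, h1, h2⟩ := mem_sbDom.1 hz
  simp only [oneE_f, Edge.onePlus_f, tqE_f] at h1 h2
  simp only [Q1, map_add, map_mul, map_sub, map_one, aeval_C, aeval_X, eq_ratCast]
  have hm : 0 ≤ z 1 - 1 := by linarith
  have hm' : z 1 - 1 ≤ z 0 := by
    have h3 : z 0 / (1 + z 0) ≤ z 0 := div_le_self h0 (by linarith)
    linarith
  have := cmul_ge_neg hc hm
  nlinarith

/-- Auxiliary step `Q2_ge` (§5): Q2 ge. [bookkeeping] -/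
theorem Q2_ge {c : ℚ} (hc : -1 ≤ c ∧ c ≤ 1) {z : Fin 2 → ℝ} (hz : z ∈ sbDom oneE rE.onePlus) :
    (1 : ℝ) ≤ aeval z (Q2 c) := by
  obtain ⟨⟨h0, h0'⟩, h1, h2⟩ := mem_sbDom.1 hz
  simp only [oneE_f, Edge.onePlus_f, rE_f] at h1 h2
  simp only [Q2, map_add, map_mul, map_sub, map_one, aeval_C, aeval_X, eq_ratCast]
  have hm : 0 ≤ z 0 * (z 1 - 1) := mul_nonneg h0 (by linarith)
  have hm' : z 0 * (z 1 - 1) ≤ z 0 := by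
    have h3 : z 1 - 1 ≤ 1 := by
      have : 1 / (1 + z 0) ≤ 1 := by rw [div_le_one (by linarith)]; linarith
      linarith
    nlinarith
  have := cmul_ge_neg hc hm
  nlinarith

/-- Auxiliary step `QG_pos` (§5): QG pos. [bookkeeping] -/
theorem QG_pos {c : ℚ} (hc : -1 ≤ c ∧ c ≤ 1) {x : Fin 2 → ℝ} (hx : x ∈ cube 2) : 0 < aeval x (QG c) := by
  have h0 := (hx 0).1; have h1 := (hx 1).1; have h1' := (hx 1).2
  simp only [QG, map_add, map_mul, map_pow, map_one, aeval_C, aeval_X, eq_ratCast]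
  have hm : 0 ≤ x 0 * x 1 := mul_nonneg h0 h1
  have := cmul_ge_neg hc hm
  nlinarith

/-- Auxiliary step `QP_pos` (§5): QP pos. [bookkeeping] -/
theorem QP_pos {c : ℚ} (hc : -1 ≤ c ∧ c ≤ 1) {x : Fin 2 → ℝ} (hx : x ∈ cube 2) : 0 < aeval x (QP c) := by
  have h := QG_pos hc hx
  have h0 := (hx 0).1
  simp only [QG, map_add, map_mul, map_pow, map_one, aeval_C, aeval_X, eq_ratCast] at h
  simp only [QP, map_add, map_mul, map_pow, map_one, aeval_C, aeval_X, eq_ratCast]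
  positivity

/-- Auxiliary step `abs_aeval_one_le` (§5): abs aeval one le. [bookkeeping] -/
private theorem abs_aeval_one_le (z : Fin 2 → ℝ) : |aeval z (1 : MvPolynomial (Fin 2) ℚ)| ≤ 1 := by simp
/-- Auxiliary step `abs_aeval_X0_le` (§5): abs aeval X0 le. [bookkeeping] -/
theorem abs_aeval_X0_le {L U : Edge} {z : Fin 2 → ℝ} (hz : z ∈ sbDom L U) :
    |aeval z (X 0 : MvPolynomial (Fin 2) ℚ)| ≤ 1 := by
  obtain ⟨⟨h0, h0'⟩, -, -⟩ := mem_sbDom.1 hz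
  rw [aeval_X, abs_of_nonneg h0]; exact h0'

/-- `TΔ(c) = [Δ, 1/(1 + c w v)]`, its fibre translate, and the two charted halves. -/
def TΔ (c : ℚ) (hc : -1 ≤ c ∧ c ≤ 1) : KZ.IntegralRep 2 :=
  BRq zeroE omE 1 (PΔ c) (3 / 4) 1 (by norm_num) (fun _ hz => PΔ_ge hc hz) fun z _ => abs_aeval_one_le z
/-- Auxiliary definition `TΔs` (§5): TΔs. [bookkeeping] -/
def TΔs (c : ℚ) (hc : -1 ≤ c ∧ c ≤ 1) : KZ.IntegralRep 2 :=
  BRq oneE omE.onePlus 1 (PΔs c) (3 / 4) 1 (by norm_num) (fun _ hz => PΔs_ge hc hz)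
    fun z _ => abs_aeval_one_le z
/-- Auxiliary definition `R1` (§5): R1. [bookkeeping] -/
def R1 (c : ℚ) (hc : -1 ≤ c ∧ c ≤ 1) : KZ.IntegralRep 2 :=
  BRq oneE tqE.onePlus 1 (Q1 c) 1 1 one_pos (fun _ hz => Q1_ge hc hz) fun z _ => abs_aeval_one_le z
/-- Auxiliary definition `R2` (§5): R2. [bookkeeping] -/
def R2 (c : ℚ) (hc : -1 ≤ c ∧ c ≤ 1) : KZ.IntegralRep 2 :=
  BRq oneE rE.onePlus 1 (Q2 c) 1 1 one_pos (fun _ hz => Q2_ge hc hz) fun z _ => abs_aeval_one_le z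
/-- The box forms `Pa(c) = [□², 1/((1+u)Q_G)]`, `Pb(c) = [□², u/((1+u)Q_G)]`, `G(c) = [□², 1/Q_G]`,
`Q_G = (1+u)² + c u σ`. -/
def Pa (c : ℚ) (hc : -1 ≤ c ∧ c ≤ 1) : RFun 2 := ⟨1, QP c, fun _ hx => (QP_pos hc hx).ne'⟩
/-- Auxiliary definition `Pb` (§5): Pb. [bookkeeping] -/
def Pb (c : ℚ) (hc : -1 ≤ c ∧ c ≤ 1) : RFun 2 := ⟨X 0, QP c, fun _ hx => (QP_pos hc hx).ne'⟩
/-- Auxiliary definition `Gc` (§5): Gc. [bookkeeping] -/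
def Gc (c : ℚ) (hc : -1 ≤ c ∧ c ≤ 1) : RFun 2 := ⟨1, QG c, fun _ hx => (QG_pos hc hx).ne'⟩

/-- (m1) fibre translation `TΔ ≡ TΔs`. -/
theorem m1 (c : ℚ) (hc : -1 ≤ c ∧ c ≤ 1) : KZ.of (TΔ c hc) - KZ.of (TΔs c hc) ∈ KZ.relations := by
  refine rel_shift omE (TΔ c hc) (TΔs c hc) rfl rfl fun z _ => ?_
  simp only [TΔ, TΔs, BRq_integrand, PΔ, PΔs, map_add, map_mul, map_sub, map_one, aeval_C, aeval_X,
    eq_ratCast, snoc2_zero, snoc2_one, init2_zero, add_sub_cancel_left]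

/-- (m2) base cut at `w = ½`. -/
theorem m2 (c : ℚ) (hc : -1 ≤ c ∧ c ≤ 1) :
    KZ.of (TΔs c hc) - KZ.of (VB (TΔs c hc) omE rfl 0 (1 / 2) le_rfl (by norm_num)) -
      KZ.of (VB (TΔs c hc) omE rfl (1 / 2) 1 (by norm_num) le_rfl) ∈ KZ.relations :=
  vcut (TΔs c hc) omE rfl (1 / 2) (by norm_num) (by norm_num)

/-- (m3) base chart `w = 1/(1+u)` (reflection ∘ Möbius): `R1 ≡` the right half. -/
theorem m3 (c : ℚ) (hc : -1 ≤ c ∧ c ≤ 1) :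
    KZ.of (R1 c hc) - KZ.of (VB (TΔs c hc) omE rfl (1 / 2) 1 (by norm_num) le_rfl) ∈ KZ.relations := by
  obtain ⟨κ, hκ⟩ : ∃ κ : ℝ → ℝ, κ = fun t => 1 / (1 + t) := ⟨_, rfl⟩
  obtain ⟨κd, hκd⟩ : ∃ κd : ℝ → ℝ, κd = fun t => -1 / ((1 + t) * (1 + t)) := ⟨_, rfl⟩
  have hder : ∀ t ∈ Icc (0 : ℝ) 1, HasDerivAt κ (κd t) t := by
    intro t ht
    simp only [hκ, hκd]
    have h1 : (1 + t) ≠ 0 := by linarith [ht.1]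
    have h : HasDerivAt (fun x : ℝ => 1 / (1 + x)) ((0 * (1 + t) - 1 * 1) / (1 + t) ^ 2) t :=
      (hasDerivAt_const t 1).div ((hasDerivAt_id' t).const_add 1) h1
    exact h.congr_deriv (by field_simp; try ring)
  obtain ⟨hinj, himg⟩ := injOn_image_of_deriv_neg' zero_le_one hder fun t ht => by
    rw [hκd]; have := ht.1; exact div_neg_of_neg_of_pos (by norm_num) (by positivity)
  have hκ0 : κ 0 = 1 := by rw [hκ]; norm_num
  have hκ1 : κ 1 = 1 / 2 := by rw [hκ]; norm_num
  rw [hκ0, hκ1] at himg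
  refine rel_base κ κd 1 (1 + X 0) (fun y hy => ?_) (fun y hy => ?_) hder hinj (1 / 2) 1
    (by rw [himg]; norm_num) (fun y => tqE.onePlus.f (y 0)) (fun y => omE.onePlus.f (y 0))
    (fun y hy => ?_) _ _ rfl rfl fun z hz => ?_
  · have := (I01 hy).1; simp only [map_add, map_one, aeval_X]; positivity
  · simp [hκ]
  · have h0 := (I01 hy).1
    simp only [Edge.onePlus_f, tqE_f, omE_f, hκ]
    have h1 : (1 + y 0) ≠ 0 := by linarith
    field_simp
    try ring
  · have hz' : z ∈ sbDom oneE tqE.onePlus := hz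
    have hQ := Q1_ge hc hz'
    obtain ⟨⟨h0, h0'⟩, h1, h2⟩ := mem_sbDom.1 hz'
    simp only [Q1, map_add, map_mul, map_sub, map_one, aeval_C, aeval_X, eq_ratCast] at hQ
    simp only [R1, TΔs, BRq_integrand, VB_integrand, Q1, PΔs, map_add, map_mul, map_sub, map_one,
      aeval_C, aeval_X, eq_ratCast, snoc2_zero, snoc2_one, hκ, hκd]
    rw [show |(-1 : ℝ) / ((1 + z 0) * (1 + z 0))| = 1 / ((1 + z 0) * (1 + z 0)) by
      rw [abs_div, abs_neg, abs_one, abs_of_pos (by positivity)]]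
    have hu : (1 : ℝ) + z 0 ≠ 0 := by linarith
    have hD : (1 : ℝ) + z 0 + (c : ℝ) * (z 1 - 1) ≠ 0 := by
      intro h; rw [h, mul_zero] at hQ; linarith
    have hD' : (1 : ℝ) + (c : ℝ) * (1 / (1 + z 0)) * (z 1 - 1) ≠ 0 := by
      rw [show (1 : ℝ) + (c : ℝ) * (1 / (1 + z 0)) * (z 1 - 1) = (1 + z 0 + (c : ℝ) * (z 1 - 1)) / (1 + z 0)
        by field_simp; try ring]
      exact div_ne_zero hD hu
    field_simp
    try ring

/-- (m4) base chart `w = u/(1+u)`: `R2 ≡` the left half. -/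
theorem m4 (c : ℚ) (hc : -1 ≤ c ∧ c ≤ 1) :
    KZ.of (R2 c hc) - KZ.of (VB (TΔs c hc) omE rfl 0 (1 / 2) le_rfl (by norm_num)) ∈ KZ.relations := by
  obtain ⟨κ, hκ⟩ : ∃ κ : ℝ → ℝ, κ = fun t => t / (1 + t) := ⟨_, rfl⟩
  obtain ⟨κd, hκd⟩ : ∃ κd : ℝ → ℝ, κd = fun t => 1 / ((1 + t) * (1 + t)) := ⟨_, rfl⟩
  have hder : ∀ t ∈ Icc (0 : ℝ) 1, HasDerivAt κ (κd t) t := by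
    intro t ht
    simp only [hκ, hκd]
    have h1 : (1 + t) ≠ 0 := by linarith [ht.1]
    have h : HasDerivAt (fun x : ℝ => x / (1 + x)) ((1 * (1 + t) - t * 1) / (1 + t) ^ 2) t :=
      (hasDerivAt_id' t).div ((hasDerivAt_id' t).const_add 1) h1
    exact h.congr_deriv (by field_simp; try ring)
  obtain ⟨hinj, himg⟩ := injOn_image_of_deriv_pos' zero_le_one hder fun t ht => by
    rw [hκd]; have := ht.1; positivity
  have hκ0 : κ 0 = 0 := by rw [hκ]; norm_num
  have hκ1 : κ 1 = 1 / 2 := by rw [hκ]; norm_num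
  rw [hκ0, hκ1] at himg
  refine rel_base κ κd (X 0) (1 + X 0) (fun y hy => ?_) (fun y hy => ?_) hder hinj 0 (1 / 2)
    (by rw [himg]; norm_num) (fun y => rE.onePlus.f (y 0)) (fun y => omE.onePlus.f (y 0))
    (fun y hy => ?_) _ _ rfl rfl fun z hz => ?_
  · have := (I01 hy).1; simp only [map_add, map_one, aeval_X]; positivity
  · simp [hκ]
  · have h0 := (I01 hy).1
    simp only [Edge.onePlus_f, rE_f, omE_f, hκ]
    have h1 : (1 + y 0) ≠ 0 := by linarith
    field_simp
    try ring
  · have hz' : z ∈ sbDom oneE rE.onePlus := hz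
    have hQ := Q2_ge hc hz'
    obtain ⟨⟨h0, h0'⟩, h1, h2⟩ := mem_sbDom.1 hz'
    simp only [Q2, map_add, map_mul, map_sub, map_one, aeval_C, aeval_X, eq_ratCast] at hQ
    simp only [R2, TΔs, BRq_integrand, VB_integrand, Q2, PΔs, map_add, map_mul, map_sub, map_one,
      aeval_C, aeval_X, eq_ratCast, snoc2_zero, snoc2_one, hκ, hκd]
    rw [show |(1 : ℝ) / ((1 + z 0) * (1 + z 0))| = 1 / ((1 + z 0) * (1 + z 0)) by
      rw [abs_of_pos (by positivity)]]
    have hu : (1 : ℝ) + z 0 ≠ 0 := by linarith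
    have hD : (1 : ℝ) + z 0 + (c : ℝ) * z 0 * (z 1 - 1) ≠ 0 := by
      intro h; rw [h, mul_zero] at hQ; linarith
    have hD' : (1 : ℝ) + (c : ℝ) * (z 0 / (1 + z 0)) * (z 1 - 1) ≠ 0 := by
      rw [show (1 : ℝ) + (c : ℝ) * (z 0 / (1 + z 0)) * (z 1 - 1) =
        (1 + z 0 + (c : ℝ) * z 0 * (z 1 - 1)) / (1 + z 0) by field_simp; try ring]
      exact div_ne_zero hD hu
    field_simp
    try ring

/-- (m5) affine fibre map `s = 1 + uσ/(1+u)`: `Pb ≡ R1`. -/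
theorem m5 (c : ℚ) (hc : -1 ≤ c ∧ c ≤ 1) : KZ.of (Pb c hc).rep - KZ.of (R1 c hc) ∈ KZ.relations := by
  refine box_to_band tqE (fun t ht => by have := ht.1; simp only [tqE_f]; positivity)
    (fun t ht => ?_) (Pb c hc) (R1 c hc) rfl fun z hz h0 h0' => ?_
  · have h1 : (1 : ℝ) + t ≠ 0 := by linarith [ht.1]
    apply DifferentiableAt.differentiableWithinAt
    show DifferentiableAt ℝ (fun t : ℝ => t / (1 + t)) t
    fun_prop (disch := assumption)
  · have hG := QG_pos hc hz
    have h1u := (hz 1).2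
    simp only [QG, map_add, map_mul, map_pow, map_one, aeval_C, aeval_X, eq_ratCast] at hG
    simp only [RFun.fn, Pb, R1, QP, Q1, BRq_integrand, map_add, map_mul, map_sub, map_pow, map_one,
      aeval_C, aeval_X, eq_ratCast, snoc2_zero, snoc2_one, init2_zero, tqE_f, add_sub_cancel_left]
    have hu : (1 : ℝ) + z 0 ≠ 0 := by linarith
    have hD : ((1 : ℝ) + z 0) ^ 2 + (c : ℝ) * z 0 * z 1 ≠ 0 := hG.ne'
    have hD' : (1 : ℝ) + z 0 + (c : ℝ) * (z 0 / (1 + z 0) * z 1) ≠ 0 := by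
      rw [show (1 : ℝ) + z 0 + (c : ℝ) * (z 0 / (1 + z 0) * z 1) =
        ((1 + z 0) ^ 2 + (c : ℝ) * z 0 * z 1) / (1 + z 0) by field_simp; try ring]
      exact div_ne_zero hD hu
    field_simp
    try ring

end Summit.KontsevichZagierPeriods.RootDecompQuadraticDescent.Pair18
end
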